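import Literature.NumberTheory.GaloisRepresentations.SemiLocalShapiro
import Literature.Algebra.Homology.CoinducedConjugation
import Literature.NumberTheory.GaloisRepresentations.LocalCanonicalFundamentalClassAbstract
import HarnessLib

/-!
# The semi-local Shapiro isomorphism at conjugate places: `Sh_{σw} = T_σ ∘ Sh_w`
# (Tate, C–F VII §7.2: "the cohomology groups `H^r(G_w, L_w^*)` are canonically isomorphic for all `w` over `v`")

Topic `NumberTheory/GaloisRepresentations`; namespaces `Literature.Algebra.Homology` (§1, one generic lemma) and
`Literature.NumberTheory.GaloisRepresentations.SemiLocal` (§2–§4), continuing `SemiLocalShapiro.lean`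
(`unitsRep F E v = ∏_{w∣v} E_wˣ`, `localUnitsRep w = E_wˣ` as a `G_w`-module, `groupCohomologyUnitsRepIso w n :
Hⁿ(G, ∏_{w∣v} E_wˣ) ≅ Hⁿ(G_w, E_wˣ)` = `(functor).mapIso (unitsRepIsoCoind w) ≪≫ coindIso`) with the engine's
`ShapiroExplicit` (`coindIso_hom_eq`: Mathlib's Shapiro isomorphism is `Hⁿ(S ↪ G, ev₁)`) and
`GroupCohomologyInnerAutomorphism` (`map_conj_eq_id`: inner automorphisms act trivially).  Definitions with bodies
(`unitsProjHom`, `stabilizerConj`, `transportAlgEquiv`) and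
theorems; NO named fact, no `sorry`, no instance, no notation; number fields in `Type`.

Mathematics (Tate, C–F VII §7.2, held copy p0216–p0217; Brown III (8.3)).  The Shapiro isomorphism
`Sh_w : Hⁿ(G, ∏_{w'∣v} E_{w'}ˣ) ⥲ Hⁿ(G_w, E_wˣ)` is restriction to `G_w` followed by the projection to the
`w`-component (§2, `groupCohomologyUnitsRepIso_hom_eq`).  For `σ ∈ G` the data at `σw` are the transport of the
data at `w`: `G_{σw} = σ G_w σ⁻¹`, `σ_w : E_w ⥲ E_{σw}`, `(σu)_{σw} = σ_w(u_w)`.  Since the inner automorphism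
`(h ↦ σ⁻¹hσ, u ↦ σu)` of `(G, ∏ E_wˣ)` acts trivially on `Hⁿ(G, ∏ E_wˣ)`, one gets
**`Sh_{σw} = T_σ ∘ Sh_w`** with `T_σ = Hⁿ(c_σ, σ_w) : Hⁿ(G_w, E_wˣ) → Hⁿ(G_{σw}, E_{σw}ˣ)`, `c_σ(s') = σ⁻¹ s' σ`
and after the identifications `G_w ≃ Gal(E_w/F_v)`, `G_{σw} ≃ Gal(E_{σw}/F_v)` the map `T_σ` is the transport of
`Hⁿ(Gal(·/F_v), ·ˣ)` along the `F_v`-algebra isomorphism `σ_w : E_w ≃ₐ[F_v] E_{σw}`; the file proves the composite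
statement directly (`groupCohomologyUnitsRepIsoAut_hom_eq_comp_transport`, §4).  This is the input for the
independence of the local invariants of `H²(G, J_E)` from the choice of `w ∣ v` (file
`IdeleLocalInvariantsCanonical.lean`).

## What is formalised

* §1 `Literature.Algebra.Homology.map_eq_map_of_conj` — generic: two morphisms of pairs `(H, Y) → (G, A)` differing by an
  inner automorphism of `(G, A)` induce the same `Hⁿ(G, A) → Hⁿ(H, Y)`.
* §2 `unitsProjHom w` (`π_w` as a `G_w`-morphism), **`groupCohomologyUnitsRepIso_hom_eq`** (`Sh_w = Hⁿ(G_w ↪ G, π_w)`).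
* §3 (for `h : σ • w = w'`) `coe_smul_eq_coe`, `stabilizerConj σ h : G_{w'} →* G_w` (`s' ↦ σ⁻¹s'σ`),
  `transportAlgEquiv σ h : E_w ≃ₐ[F_v] E_{w'}`, `decompAlgEquiv_stabilizerConj` (`(σ⁻¹s'σ)_w = σ_w⁻¹ s'_{w'} σ_w`),
  `coe_decompMulEquiv_symm_autCongr_symm`.
* §4 **`groupCohomologyUnitsRepIsoAut_hom_eq_comp_transport`**: `Sh^{Aut}_{w'} = unitsCohomologyIso(σ_w) ∘ Sh^{Aut}_w`
  (door-c6's transport of `Hⁿ(Gal(·/F_v), ·ˣ)` along `σ_w`), and its element form.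
  (Stated for `w' = σ • w` as a hypothesis and compared only at the `Gal(E_w/F_v)`-level: the types the kernel must
  compare then never differ merely by the place, which keeps the check instant.)

## References
* J. W. S. Cassels, A. Fröhlich (eds.), *Algebraic Number Theory* (1967), Ch. VII (Tate) §7.2 (and §1.1).
  [CasselsFrohlichANT1967]
* K. S. Brown, *Cohomology of Groups*, GTM 87 (1982), III §5–§6, (8.3). [Brown1982CohomologyGroups]
* J.-P. Serre, *Local Fields*, GTM 67 (1979), Ch. VII §5 Prop. 3; Ch. XI §1 (iv). [SerreLocalFields1979]
-/

noncomputable section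

open CategoryTheory groupCohomology

/-! ## §1. Generic: Shapiro-type maps at conjugate data -/

namespace Literature.Algebra.Homology

universe u

variable {k G : Type u} [CommRing k] [Group G]

/-- **Two morphisms of pairs `(H, Y) → (G, A)` that differ by an inner automorphism of `(G, A)` induce the same map
`Hⁿ(G, A) → Hⁿ(H, Y)`**: if `f₂(x) = t⁻¹ f₁(x) t` and `φ₁(t·a) = φ₂(a)` then `Hⁿ(f₁, φ₁) = Hⁿ(f₂, φ₂)` — insert the inner
automorphism `(g ↦ t⁻¹gt, ρ(t))` of `(G, A)`, which acts trivially (`map_conj_eq_id`), in front of `Hⁿ(f₁, φ₁)`.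
[cite: SerreLocalFields1979, Ch. VII §5 Prop. 3][cite: Brown1982CohomologyGroups, III (8.3)] -/
theorem map_eq_map_of_conj {H : Type u} [Group H] {A : Rep k G} {Y : Rep k H} (t : G) (f₁ f₂ : H →* G)
    (hf : ∀ x, f₂ x = t⁻¹ * f₁ x * t) (φ₁ : Rep.res f₁ A ⟶ Y) (φ₂ : Rep.res f₂ A ⟶ Y)
    (hφ : ∀ a : A, φ₁.hom (A.ρ t a) = φ₂.hom a) (n : ℕ) :
    groupCohomology.map f₁ φ₁ n = groupCohomology.map f₂ φ₂ n := by
  have h1 := map_conj_eq_id A t n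
  have eL : groupCohomology.map f₁ φ₁ n =
      groupCohomology.map ((conjBy t).comp f₁) ((Rep.resFunctor f₁).map (conjRepHom A t) ≫ φ₁) n := by
    rw [groupCohomology.map_comp, h1, Category.id_comp]
  rw [eL]
  refine map_congr' ?_ _ _ (fun a => ?_) n
  · ext x
    simp [conjBy_apply, hf]
  · exact hφ a

end Literature.Algebra.Homology

namespace Literature.NumberTheory.GaloisRepresentations

namespace SemiLocal

open NumberField IsDedekindDomain Literature.NumberTheory.Automorphic Literature.Algebra.Homology

variable {F : Type} [Field F] [NumberField F] {E : Type} [Field E] [NumberField E] [Algebra F E]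
variable {v : HeightOneSpectrum (𝓞 F)}

/-! ## §2. The Shapiro isomorphism is restriction followed by the `w`-projection -/

/-- **The `w`-projection `π_w : (∏_{w'∣v} E_{w'}ˣ)|_{G_w} ⟶ E_wˣ` as a morphism of `G_w`-modules**
(`(h u)_w = h_w(u_w)` for `h ∈ G_w`). [cite: Brown1982CohomologyGroups, III §5 Prop. (5.8)] -/
def unitsProjHom (w : Place F E v) :
    Rep.res (MulAction.stabilizer (E ≃ₐ[F] E) w).subtype (unitsRep F E v) ⟶ localUnitsRep w :=
  Rep.ofHom (LinearMap.intertwiningMap_of_isIntertwiningMap _ _ (unitsProj w) fun g x => by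
    show unitsProj w (unitsRepr F E v (g : E ≃ₐ[F] E) x) = (localUnitsRep w).ρ g (unitsProj w x)
    apply Additive.toMul.injective
    refine Units.ext ?_
    rw [val_toMul_unitsProj, val_toMul_localUnitsRep_ρ, val_toMul_unitsProj,
      Representation.ofMulDistribMulAction_apply_apply, toMul_ofMul, val_smul_units, smul_apply]
    exact galAdicCompletionMap_congr_place
      (inv_smul_eq_iff.mpr (MulAction.mem_stabilizer_iff.mp g.2).symm) _ _ _)

/-- Unfolding: `unitsProjHom w` is `unitsProj w` on elements. [cite: Brown1982CohomologyGroups, III §5 Prop. (5.8)] -/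
theorem unitsProjHom_hom_apply (w : Place F E v) (x : Additive (SemiLocal F E v)ˣ) :
    (unitsProjHom w).hom x = unitsProj w x := rfl

/-- **The semi-local Shapiro isomorphism is restriction to `G_w` followed by the `w`-projection**:
`Sh_w = Hⁿ(G_w ↪ G, π_w)` (Mathlib's `coindIso` is `Hⁿ(S ↪ G, ev₁)`, and `ev₁ ∘ (u ↦ (g ↦ (gu)_w)) = π_w`).
[cite: CasselsFrohlichANT1967, Ch. VII §7.2][cite: Brown1982CohomologyGroups, III (6.2)] -/
theorem groupCohomologyUnitsRepIso_hom_eq [IsGalois F E] (w : Place F E v) (n : ℕ) :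
    (groupCohomologyUnitsRepIso w n).hom =
      groupCohomology.map (MulAction.stabilizer (E ≃ₐ[F] E) w).subtype (unitsProjHom w) n := by
  rw [groupCohomologyUnitsRepIso, Iso.trans_hom, Functor.mapIso_hom, coindIso_hom_eq]
  refine (groupCohomology.map_comp (A := unitsRep F E v) (MonoidHom.id (E ≃ₐ[F] E)) (MulAction.stabilizer (E ≃ₐ[F] E) w).subtype
    (unitsRepIsoCoind w).hom (coindCounit _ (localUnitsRep w)) n).symm.trans ?_
  refine map_congr' (MonoidHom.id_comp _) _ _ (fun x => ?_) n
  change ((unitsRepIsoCoind w).hom.hom x).1 1 = unitsProj w x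
  rw [unitsRepIsoCoind_hom_apply, one_smul]
  rfl

/-! ## §3. Conjugate places: `w' = σ w` -/

/-! Everything below is stated for two places `w, w'` above `v` and `σ ∈ G` with `h : σ • w = w'`, and the comparison
is made at the level of `Hⁿ(Gal(E_w/F_v), E_wˣ)` / `Hⁿ(Gal(E_{w'}/F_v), E_{w'}ˣ)` (never between `G_w`- and
`G_{w'}`-modules directly): this keeps every type the kernel has to compare syntactically apart. -/

variable {w w' : Place F E v} {σ : E ≃ₐ[F] E}

/-- `σ • ↑w = ↑w'` on `HeightOneSpectrum (𝓞 E)` from `σ • w = w'` on `Place F E v`. [cite: CasselsFrohlichANT1967, Ch. VII §1.1] -/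
theorem coe_smul_eq_coe (h : σ • w = w') :
    σ • (w : HeightOneSpectrum (𝓞 E)) = (w' : HeightOneSpectrum (𝓞 E)) :=
  congrArg (fun p : Place F E v => (p : HeightOneSpectrum (𝓞 E))) h

variable (σ) in
/-- **`c_σ : G_{w'} →* G_w`, `s' ↦ σ⁻¹ s' σ`** (for `σ w = w'`). [cite: CasselsFrohlichANT1967, Ch. VII §7.2] -/
def stabilizerConj (h : σ • w = w') :
    MulAction.stabilizer (E ≃ₐ[F] E) w' →* MulAction.stabilizer (E ≃ₐ[F] E) w where
  toFun s' := ⟨σ⁻¹ * s' * σ, by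
    rw [MulAction.mem_stabilizer_iff, mul_smul, mul_smul, h, MulAction.mem_stabilizer_iff.mp s'.2, ← h,
      inv_smul_smul]⟩
  map_one' := Subtype.ext (by simp)
  map_mul' a b := Subtype.ext (by
    change σ⁻¹ * (a * b : E ≃ₐ[F] E) * σ = σ⁻¹ * a * σ * (σ⁻¹ * b * σ)
    group)

/-- Unfolding `stabilizerConj`. [cite: CasselsFrohlichANT1967, Ch. VII §7.2] -/
@[simp] theorem coe_stabilizerConj_apply (h : σ • w = w') (s' : MulAction.stabilizer (E ≃ₐ[F] E) w') :
    ((stabilizerConj σ h s' : MulAction.stabilizer (E ≃ₐ[F] E) w) : E ≃ₐ[F] E) = σ⁻¹ * s' * σ := rfl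

variable (σ) in
/-- **`σ_w : E_w ≃ₐ[F_v] E_{w'}`** (`σ w = w'`), the Galois transport of completions as an `F_v`-algebra isomorphism
(Tate: "if `w` is over `v` so is `σw` and this map is a `K_v`-isomorphism"). [cite: CasselsFrohlichANT1967, Ch. VII §1.1] -/
def transportAlgEquiv (h : σ • w = w') :
    (w : HeightOneSpectrum (𝓞 E)).adicCompletion E ≃ₐ[v.adicCompletion F]
      (w' : HeightOneSpectrum (𝓞 E)).adicCompletion E :=
  AlgEquiv.ofRingEquiv (f := galAdicCompletionEquiv (L := E) σ (coe_smul_eq_coe h))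
    fun c => galAdicCompletionMap_adicCompletionOfLiesOver F σ v (coe_smul_eq_coe h) c

/-- `transportAlgEquiv σ h` is `galAdicCompletionMap σ` as a function. [cite: CasselsFrohlichANT1967, Ch. VII §1.1] -/
@[simp] theorem transportAlgEquiv_apply (h : σ • w = w') (x : (w : HeightOneSpectrum (𝓞 E)).adicCompletion E) :
    transportAlgEquiv σ h x = galAdicCompletionMap σ (coe_smul_eq_coe h) x := rfl

/-- The inverse of `transportAlgEquiv σ h` is the transport along `σ⁻¹`. [cite: CasselsFrohlichANT1967, Ch. VII §1.1] -/
theorem transportAlgEquiv_symm_apply (h : σ • w = w') (y : (w' : HeightOneSpectrum (𝓞 E)).adicCompletion E) :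
    (transportAlgEquiv σ h).symm y =
      galAdicCompletionMap σ⁻¹ (inv_smul_eq_of_smul_eq (coe_smul_eq_coe h)) y := rfl

/-- **`c_σ` and the decomposition isomorphisms**: `(σ⁻¹ s' σ)_w = σ_w⁻¹ ∘ s'_{w'} ∘ σ_w`, i.e.
`decompAlgEquiv w (c_σ s') = (transportAlgEquiv σ h).autCongr.symm (decompAlgEquiv w' s')`.
[cite: CasselsFrohlichANT1967, Ch. VII §1.1] -/
theorem decompAlgEquiv_stabilizerConj (h : σ • w = w') (s' : MulAction.stabilizer (E ≃ₐ[F] E) w') :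
    decompAlgEquiv w (stabilizerConj σ h s') =
      (transportAlgEquiv σ h).autCongr.symm (decompAlgEquiv w' s') := by
  apply AlgEquiv.ext
  intro x
  rw [AlgEquiv.autCongr_symm, AlgEquiv.autCongr_apply, AlgEquiv.trans_apply, AlgEquiv.trans_apply,
    AlgEquiv.symm_symm, transportAlgEquiv_apply, transportAlgEquiv_symm_apply, decompAlgEquiv_apply,
    decompAlgEquiv_apply, galAdicCompletionMap_galAdicCompletionMap, galAdicCompletionMap_galAdicCompletionMap]
  exact galAdicCompletionMap_congr_left E rfl _ _ _

/-- In `G`: `(decompMulEquiv w)⁻¹ (σ_w⁻¹ ∘ (decompMulEquiv w' s') ∘ σ_w) = σ⁻¹ s' σ`.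
[cite: CasselsFrohlichANT1967, Ch. VII §1.1] -/
theorem coe_decompMulEquiv_symm_autCongr_symm [IsGalois F E] (h : σ • w = w')
    (s' : MulAction.stabilizer (E ≃ₐ[F] E) w') :
    ((decompMulEquiv w).symm ((transportAlgEquiv σ h).autCongr.symm (decompMulEquiv w' s')) : E ≃ₐ[F] E) =
      σ⁻¹ * s' * σ := by
  have key : (decompMulEquiv w).symm ((transportAlgEquiv σ h).autCongr.symm (decompMulEquiv w' s')) =
      stabilizerConj σ h s' := by
    rw [MulEquiv.symm_apply_eq, decompMulEquiv_apply, decompMulEquiv_apply, decompAlgEquiv_stabilizerConj]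
  rw [key, coe_stabilizerConj_apply]

/-! ## §4. `Sh^{Aut}_{w'} = (transport along σ_w) ∘ Sh^{Aut}_w` -/

/-- **The semi-local Shapiro isomorphisms at two places above `v` differ by the transport along `σ_w`**: for
`σ w = w'`, `Sh^{Aut}_{w'} = unitsCohomologyIso(σ_w) ∘ Sh^{Aut}_w` on `Hⁿ(G, ∏_{w∣v} E_wˣ)`, where
`Sh^{Aut}_w : Hⁿ(G, ∏ E_wˣ) ⥲ Hⁿ(Gal(E_w/F_v), E_wˣ)` is `groupCohomologyUnitsRepIsoAut w n` and `unitsCohomologyIso` is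
door-c6's transport of `Hⁿ(Gal(·/F_v), ·ˣ)` along an `F_v`-isomorphism.  Both sides are `Hⁿ` of a morphism of pairs
`(Gal(E_{w'}/F_v), E_{w'}ˣ) → (G, ∏ E_wˣ)`; they differ by the inner automorphism `(g ↦ σ⁻¹gσ, u ↦ σu)` of
`(G, ∏ E_wˣ)`, which acts trivially. [cite: CasselsFrohlichANT1967, Ch. VII §7.2][cite: SerreLocalFields1979, Ch. VII §5 Prop. 3] -/
theorem groupCohomologyUnitsRepIsoAut_hom_eq_comp_transport [IsGalois F E] (h : σ • w = w') (n : ℕ) :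
    (groupCohomologyUnitsRepIsoAut w' n).hom =
      (groupCohomologyUnitsRepIsoAut w n).hom ≫ (UnitsLayer.unitsCohomologyIso (transportAlgEquiv σ h) n).hom := by
  rw [groupCohomologyUnitsRepIsoAut, groupCohomologyUnitsRepIsoAut, Iso.trans_hom, Iso.trans_hom,
    groupCohomologyUnitsRepIso_hom_eq, groupCohomologyUnitsRepIso_hom_eq, groupCohomologyLocalUnitsRepIso,
    groupCohomologyLocalUnitsRepIso, UnitsLayer.unitsCohomologyIso, groupCohomology.mapIso_hom,
    groupCohomology.mapIso_hom, groupCohomology.mapIso_hom, ← groupCohomology.map_comp, ← groupCohomology.map_comp,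
    ← groupCohomology.map_comp]
  refine map_eq_map_of_conj (A := unitsRep F E v) σ _ _ (fun ψ => ?_) _ _ (fun a => ?_) n
  · obtain ⟨s', rfl⟩ := (decompMulEquiv w').surjective ψ
    change ((decompMulEquiv w).symm ((transportAlgEquiv σ h).autCongr.symm (decompMulEquiv w' s')) : E ≃ₐ[F] E) =
      σ⁻¹ * ((decompMulEquiv w').symm (decompMulEquiv w' s') : E ≃ₐ[F] E) * σ
    rw [coe_decompMulEquiv_symm_autCongr_symm h, MulEquiv.symm_apply_apply]
  · apply (Additive.toMul (α := ((w' : HeightOneSpectrum (𝓞 E)).adicCompletion E)ˣ)).injective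
    refine Units.ext ?_
    change ((σ • (Additive.toMul a : (SemiLocal F E v)ˣ) : (SemiLocal F E v)ˣ) : SemiLocal F E v) w' =
      transportAlgEquiv σ h (((Additive.toMul a : (SemiLocal F E v)ˣ) : SemiLocal F E v) w)
    rw [val_smul_units, smul_apply, transportAlgEquiv_apply]
    exact galAdicCompletionMap_congr_place (inv_smul_eq_iff.mpr h.symm) _ _ _

/-- Element form of `groupCohomologyUnitsRepIsoAut_hom_eq_comp_transport`. [cite: CasselsFrohlichANT1967, Ch. VII §7.2] -/
theorem groupCohomologyUnitsRepIsoAut_hom_apply_eq_transport [IsGalois F E] (h : σ • w = w') (n : ℕ)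
    (x : groupCohomology (unitsRep F E v) n) :
    (groupCohomologyUnitsRepIsoAut w' n).hom x =
      (UnitsLayer.unitsCohomologyIso (transportAlgEquiv σ h) n).hom ((groupCohomologyUnitsRepIsoAut w n).hom x) := by
  rw [groupCohomologyUnitsRepIsoAut_hom_eq_comp_transport h]
  rfl

end SemiLocal

end Literature.NumberTheory.GaloisRepresentations

end
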